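import Summits.QuantumFields.YangMills.Theorems.BalabanUVNodesN11RunGuardIsCouplingFloor
import Summits.QuantumFields.YangMills.Theses.BalabanUVNodes

/-!
# DAG node N11 × K1⁸ — WHAT ANY PROOF OF THE DECIDING CRUX `StabilityBRunRowsAtRecordR13SepCoPH` (rev 27) MUST DELIVER: the record's §2 form at partition-INCOMPATIBLE runs OF
# EVERY LENGTH in every small window — from the crux's OWN consequent: its one-sided printed window (`B16.Thm1Printed`), its window clause, and its OWN RUN ROW
# `|β_k(g_0,…,g_k) − b_k| ≤ r` along in-window (0.20)-runs (which makes tiny bare couplings stay in the window for every `K`)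

HEADER — WORK-UNIT METADATA.  Cell `pub-ymgap`, YM-PLAN Track A (HUMAN RULING D-0062 ∕ D-0149 width seats), seat `pub-ymgap-dag-n11-w4` (g4; WIDTH SEAT 4 of 4 on NODE n11
[B14]), route `BalabanUVNodes` rev 27 (KEY MAP of record, dag-lead GATE v1.65 ∕ plan g84 [YMPLAN-G84-REV26R-LANDED]: K1⁸ `StabilityBRunRowsAtRecordR13SepCoPH` = stmt-QuantumFields-26907 is
THE DECIDING ITEM; K1⁷ 20542 `aside`), helper lane (`--kind proof --supports stmt-QuantumFields-26907 --as helper`, count-neutral).  [I] = [Balaban1987RG1], [III] = [Balaban1988Convergent],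
[V] = [Balaban1989LargeFieldII].  Over this seat's p615408 `…N11RunGuardIsCouplingFloor` (`window_genSeq_of_betaLe`, `floor_of_partCompat₁₃_top`, `not_partCompat₁₃_top_of_window_lt_threshold`) and the route file
(the crux decl BY NAME, as a HYPOTHESIS; imported DIRECTLY — this file is a cone tip, nothing should import it; p617030 `…N11K1ConsequentMeetsIncompatibleRuns` is its K1⁷ twin).

WHY THIS FILE.  p617030 typed, for K1⁷, «the consequent forces [III] Thm 1's conclusion at ONE run whose last 𝐃-cube does not fit the torus» (β-free).  The deciding crux is now K1⁸,
whose consequent = K1⁷'s ∧ the RUN ROWS at the record: `∃ b r γ₀ M, 0 < γ₀ ∧ (∀ n gs, RGEqH n β_θ gs → InInterval γ₀ n gs → ∀ k ≤ n, |β_θ k (prefixOf gs k) − b k| ≤ r) ∧ (PS floor) ∧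
(continuity)`.  The first row IS the run-wise β-ceiling of p615408 (below any fixed length `K`: `β ≤ Σ_{j<K} |b_j| + |r|`), so the crux's own letters now give the STRONG form: at the
produced `(θ, h)` (with `M = L^a`, `1 ≤ r` — every witness of record), for EVERY window `γ ≤ min(γ₀, γ₂)` (`γ₂` the printed window of `Thm1Printed`), EVERY length `K ≥ 1` and every `m`
there is an in-window run of length `K` which is NOT partition-compatible at `K` and along which the record's `Sect2Form k` holds for all `k ≤ K`.  So K1⁸ asserts [III] Thm 1's
conclusion for the record on runs of every length OUTSIDE print's standing assumption «all partitions are compatible» ([III] p. 257) — the one-block top levels where the tree's N11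
machinery reads K0's guarded proviso row `bg` (p618164 ∕ p619264 located it).  LOCATED, count-neutral; the crux is a HYPOTHESIS here, neither proved nor refuted.

WHAT THIS FILE PROVES (0 `sorry`, 0 `def`).  §1 `exists_window_not_partCompat₁₃_of_betaLe_below` (generic θ, `M = L^a`, `1 ≤ r`: the β-ceiling is needed only BELOW the length
`K`) · `betaLe_below_of_runRow` (K1⁸'s first run row ⇒ that ceiling with `B := Σ_{j<K} |b_j| + |r|`).  §2 ★★★ `incompatibleRuns_with_sect2Form_of_consequentBody₈` (θ : Stage13HParams F N,
`h : Provisos₁₃SepCoPH`, `M = L^a`, `1 ≤ r`: the K1⁸ consequent BODY ⇒ `∃ γ⋆ > 0, ∀ γ ∈ ]0, γ⋆], ∀ K ≥ 1, ∀ m, ∃ g₀`, the run `⟨K, m, g₀⟩` lies in `]0, γ]`, is NOT `PartCompat₁₃` at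
`K`, and has `Sect2Form k` for all `k ≤ K`).  §3 ★★★ `incompatibleRuns_of_stabilityBRunRowsAtRecordR13SepCoPH` (the DECIDING CRUX BY NAME as hypothesis, `N = 2`) · ★★★
`incompatibleRun_of_stabilityBRunRowsAtRecordR13SepCoPH` (β-free twin of p617030 §3 for K1⁸ at `M = L^a`, `r = 1`: ONE run, from the window clause and the threshold `e^{−L^{m−a}∕2}`).

HONEST FRAMING.  Helper lane of K1⁸; count-neutral; the crux is a HYPOTHESIS (§3), NOT proved, NOT refuted; nothing of [I]∕[III]∕[V] asserted.  N11 NOT discharged; K1⁸ NOT closed;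
counts unmoved (typed 28∕28 · discharged 5∕27).  R4 closes only the conditional finite-𝕋⁴ rung `BalabanLadder.UV` of one programme at fixed `ε = L^{−K}` — NOT ℝ⁴, NOT OS, NOT a mass
gap, NOT Clay.  No `sorry`, `axiom`, `def`, `instance`, `notation`.  Sources (SHAPE ∕ bookkeeping only): [V] Thm 1 p.355; [III] (2.1) p.254, (2.5) p.255, p.257, Thm 1 p.262; [I]
(0.18)–(0.20) pp.255–256, Thm 1 p.259, (1.20)–(1.22) p.264, §1 p.264.
-/

noncomputable section

open scoped BigOperators

namespace Summit.QuantumFields.YangMills.Theorems.BalabanUVNodesN11K1RunRowsConsequentMeetsIncompatibleRuns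

open Literature.MathematicalPhysics.QuantumFieldTheory.Balaban1983to89 T4Continuum Node00
open FlowStep (HBeta RGEqH prefixOf)
open FlowStepRuns (genSeq solveCoupling solveCoupling_pos inv_sq_solveCoupling)
open BalabanUVNodesN11PartCompatOfCouplings (log_pow_le_of_partCompat₁₃)
open BalabanUVNodesN11RunGuardIsCouplingFloor (window_genSeq_of_betaLe not_partCompat₁₃_top_of_window_lt_threshold)

/-! ## §1  The β-ceiling is needed only below the length of the run to be built -/

section Below

variable {F : T4Family} {N : ℕ} [NeZero N]

/-- An in-window generated history solves (0.20) up to its horizon (local copy; `Node00.inv_sq_genSeq_succ`). [cite: Balaban1987RG1, (0.18)–(0.20) pp.255–256] -/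
private theorem rgEqH_genSeq_of_window {β : HBeta} {γ g0 : ℝ} {n : ℕ} (hW : Step.InInterval γ n (genSeq β g0)) : RGEqH n β (genSeq β g0) := by
  intro k hk
  have h := inv_sq_genSeq_succ β g0 (hW (k + 1) (Nat.succ_le_of_lt hk)).1
  rw [one_div, one_div, h]
  ring

/-- **★ AN IN-WINDOW RUN OF LENGTH `K` THAT IS NOT PARTITION-COMPATIBLE, FROM A β-CEILING BELOW `K` ONLY** (generic θ with `θ.τ9.M = F.L^a`, `1 ≤ θ.ν.r`): if the record's β read at
the running end of every in-window (`]0, γ₀]`) solution of (0.20) of horizon `n < K` is `≤ B`, then for every `γ ∈ ]0, γ₀]` and every `m` some bare coupling generates a run of the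
record in `]0, γ]` up to `K` which is NOT `PartCompat₁₃` at `K` (p615408's construction; its hypothesis quantified all horizons). [cite: Balaban1987RG1, (0.18)–(0.20) pp.255–256, §1 p.264; Balaban1988Convergent, (2.1) p.254, (2.5) p.255, p.257] -/
theorem exists_window_not_partCompat₁₃_of_betaLe_below (θ : Stage13Params F N) {a : ℕ} (hM : θ.τ9.M = F.L ^ a) (hr : 1 ≤ θ.ν.r)
    {γ₀ B : ℝ} {K : ℕ} (hK : 1 ≤ K)
    (hB : ∀ n, n < K → ∀ gs : ℕ → ℝ, RGEqH n (betaOfRecord₁₃ F N θ) gs → Step.InInterval γ₀ n gs → betaOfRecord₁₃ F N θ n (prefixOf gs n) ≤ B)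
    {γ : ℝ} (hγ : 0 < γ) (hγ₀ : γ ≤ γ₀) (m : ℕ) :
    ∃ g0 : ℝ, Step.InInterval γ K (gOfRecord₁₃ F N θ ⟨K, m, g0⟩) ∧ ¬ PartCompat₁₃ F N θ ⟨K, m, g0⟩ K := by
  set β := betaOfRecord₁₃ F N θ with hβdef
  set B' : ℝ := max B 0 with hB'def
  have hB'0 : 0 ≤ B' := le_max_right _ _
  set T : ℝ := ((F.L ^ (F.m + K - K - a) : ℕ) : ℝ) with hTdef
  have hT0 : 0 ≤ T := by positivity
  set y : ℝ := 1 / γ ^ 2 + B' * K + Real.exp (T + 1) with hydef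
  have hγ2 : 0 < 1 / γ ^ 2 := by positivity
  have hexp : 0 < Real.exp (T + 1) := Real.exp_pos _
  have hy : 0 < y := by positivity
  set g0 : ℝ := solveCoupling y with hg0def
  have hg0 : 0 < g0 := solveCoupling_pos hy
  have hg0y : 1 / g0 ^ 2 = y := inv_sq_solveCoupling hy
  have hBrun : ∀ k, k < K → Step.InInterval γ k (genSeq β g0) → β k (prefixOf (genSeq β g0) k) ≤ B' := by
    intro k hk hWk
    have hWk₀ : Step.InInterval γ₀ k (genSeq β g0) := fun i hi => ⟨(hWk i hi).1, (hWk i hi).2.trans hγ₀⟩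
    exact (hB k hk _ (rgEqH_genSeq_of_window hWk₀) hWk₀).trans (le_max_left _ _)
  have hsmall : 1 / γ ^ 2 + B' * K ≤ 1 / g0 ^ 2 := by rw [hg0y]; linarith [hexp.le]
  obtain ⟨hW, hlow⟩ := window_genSeq_of_betaLe hγ hB'0 hg0 hBrun hsmall
  refine ⟨g0, hW, fun hPC => ?_⟩
  have hKlow := hlow K le_rfl
  have hinv : Real.exp (T + 1) ≤ (genSeq β g0 K ^ 2)⁻¹ := by
    rw [← one_div]
    linarith
  have hlogK : T + 1 ≤ Real.log (genSeq β g0 K ^ 2)⁻¹ := by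
    have h := Real.log_le_log hexp hinv
    rwa [Real.log_exp] at h
  have hcap : (Real.log (genSeq β g0 K ^ 2)⁻¹) ^ θ.ν.r ≤ T :=
    (log_pow_le_of_partCompat₁₃ θ hM ⟨K, m, g0⟩ hPC hK le_rfl).2
  have hone : 1 ≤ Real.log (genSeq β g0 K ^ 2)⁻¹ := by linarith
  have hself : Real.log (genSeq β g0 K ^ 2)⁻¹ ≤ (Real.log (genSeq β g0 K ^ 2)⁻¹) ^ θ.ν.r :=
    le_self_pow₀ hone (by omega)
  linarith

/-- **K1⁸'s FIRST RUN ROW ⇒ THE β-CEILING BELOW EVERY LENGTH**: `|β_k(g_0,…,g_k) − b_k| ≤ r` for `k ≤ n` along in-window (0.20)-runs of horizon `n` gives, for every `K`, the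
ceiling `β_n(…) ≤ Σ_{j<K} |b_j| + |r|` at the running end of every such run of horizon `n < K`. [cite: Balaban1987RG1, (1.20)–(1.22) p.264, §1 p.264 (bookkeeping)] -/
theorem betaLe_below_of_runRow {β : HBeta} {b : ℕ → ℝ} {r γ₀ : ℝ}
    (hrem : ∀ (n : ℕ) (gs : ℕ → ℝ), RGEqH n β gs → Step.InInterval γ₀ n gs → ∀ k, k ≤ n → |β k (prefixOf gs k) - b k| ≤ r) (K : ℕ) :
    ∀ n, n < K → ∀ gs : ℕ → ℝ, RGEqH n β gs → Step.InInterval γ₀ n gs →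
      β n (prefixOf gs n) ≤ (∑ j ∈ Finset.range K, |b j|) + |r| := by
  intro n hn gs hrg hI
  have h1 := (abs_le.mp (hrem n gs hrg hI n le_rfl)).2
  have h2 : b n ≤ |b n| := le_abs_self _
  have h3 : |b n| ≤ ∑ j ∈ Finset.range K, |b j| :=
    Finset.single_le_sum (f := fun j => |b j|) (fun j _ => abs_nonneg (b j)) (Finset.mem_range.mpr hn)
  have h4 : r ≤ |r| := le_abs_self _
  linarith

end Below

/-! ## §2  The consequent BODY of K1⁸ at `(θ, h)` forces the §2 form at incompatible runs of EVERY length in every small window -/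

section Body

variable {F : T4Family} {N : ℕ} [NeZero N]

/-- **★★★ THE K1⁸ CONSEQUENT AT `(θ, h)` ⇒ THE RECORD's §2 FORM AT INCOMPATIBLE RUNS OF EVERY LENGTH** (θ : Stage13HParams F N with `θ.τ9.M = F.L^a`, `1 ≤ θ.ν.r`): from `(unity ∧ slots) ∧
Admissible ∧ B16.EndStatementBPrinted (datum θ h).C ∧ (window clause) ∧ (∃ b r γ₀ M, 0 < γ₀ ∧ RUN ROW ∧ PS floor ∧ continuity)` there is `γ⋆ > 0` (= `min γ₀ γ₂`, `γ₂` the printed window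
of `Thm1Printed`) such that for every `γ ∈ ]0, γ⋆]`, every `K ≥ 1` and every `m` some bare coupling `g₀` gives a run `⟨K, m, g₀⟩` of the record lying in `]0, γ]` up to `K`, NOT
`PartCompat₁₃` at `K`, along which `Sect2Form k` holds for every `k ≤ K`.  Only the FIRST run row is read. LOCATED, count-neutral.
[cite: Balaban1989LargeFieldII, Thm 1 p.355; Balaban1988Convergent, Thm 1 p.262, (2.5) p.255, p.257; Balaban1987RG1, (0.20) p.256, (1.20)–(1.22) p.264] -/
theorem incompatibleRuns_with_sect2Form_of_consequentBody₈ (θ : Stage13HParams F N) (h : θ.Provisos₁₃SepCoPH F N) {a : ℕ} (hM : θ.τ9.M = F.L ^ a) (hr : 1 ≤ θ.ν.r)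
    (hbody : (θ.ZhUnity F N ∧ θ.SlotsNondegenerate₁₃ F N) ∧ θ.Admissible F N ∧ B16.EndStatementBPrinted (datumOfRecord₁₃SepCoPH F N θ h).C ∧
      (∃ γ₁ : ℝ, 0 < γ₁ ∧ ∀ γ : ℝ, 0 < γ → γ ≤ γ₁ → ∃ P : B12.RunParams, 1 ≤ P.K ∧ ((datumOfRecord₁₃SepCoPH F N θ h).C P).flow.InInterval γ P.K) ∧
      ∃ (b : ℕ → ℝ) (r γ₀ M : ℝ), 0 < γ₀ ∧
        (∀ (n : ℕ) (gs : ℕ → ℝ), RGEqH n (betaOfRecord₁₃ F N θ.toStage13Params) gs → Step.InInterval γ₀ n gs →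
          ∀ k, k ≤ n → |betaOfRecord₁₃ F N θ.toStage13Params k (prefixOf gs k) - b k| ≤ r) ∧
        (∀ (n : ℕ) (gs : ℕ → ℝ), RGEqH n (betaOfRecord₁₃ F N θ.toStage13Params) gs → Step.InInterval γ₀ n gs →
          ∀ k, k ≤ n → -M ≤ ∑ j ∈ Finset.Ico k n, betaOfRecord₁₃ F N θ.toStage13Params j (prefixOf gs j)) ∧
        ∀ k : ℕ, ContinuousOn (fun x : ℝ => betaOfRecord₁₃ F N θ.toStage13Params k (FlowStep.clampPrefix (betaOfRecord₁₃ F N θ.toStage13Params) γ₀ k x))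
          {x : ℝ | 0 < x ∧ x ≤ γ₀ ∧ ∀ j, j ≤ k → 1 / γ₀ ^ 2 ≤ FlowStep.Y (betaOfRecord₁₃ F N θ.toStage13Params) γ₀ j x}) :
    ∃ γs : ℝ, 0 < γs ∧ ∀ γ : ℝ, 0 < γ → γ ≤ γs → ∀ K : ℕ, 1 ≤ K → ∀ m : ℕ, ∃ g0 : ℝ,
      Step.InInterval γ K (gOfRecord₁₃ F N θ.toStage13Params ⟨K, m, g0⟩) ∧ ¬ PartCompat₁₃ F N θ.toStage13Params ⟨K, m, g0⟩ K ∧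
        ∀ k, k ≤ K → ((datumOfRecord₁₃SepCoPH F N θ h).C ⟨K, m, g0⟩).Sect2Form k := by
  obtain ⟨-, -, ⟨⟨γ₂, hγ₂, hS⟩, -⟩, -, b, r, γ₀, M, hγ₀, hrem, -, -⟩ := hbody
  refine ⟨min γ₀ γ₂, lt_min hγ₀ hγ₂, fun γ hγ hγle K hK m => ?_⟩
  obtain ⟨g0, hW, hnot⟩ := exists_window_not_partCompat₁₃_of_betaLe_below θ.toStage13Params hM hr hK (betaLe_below_of_runRow hrem K) hγ
    (hγle.trans (min_le_left _ _)) m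
  refine ⟨g0, hW, hnot, fun k hk => hS ⟨K, m, g0⟩ (fun j hj => ⟨(hW j hj).1, (hW j hj).2.trans (hγle.trans (min_le_right _ _))⟩) k hk⟩

end Body

/-! ## §3  The DECIDING CRUX BY NAME, as a hypothesis -/

section Crux

/-- **★★★ WHAT ANY PROOF OF K1⁸ DELIVERS — RUNS OF EVERY LENGTH** (the crux `Summit.QuantumFields.YangMills.Theses.BalabanUVNodes.StabilityBRunRowsAtRecordR13SepCoPH` as HYPOTHESIS, type
literally): for every family `F` with a unity Stage-13 tuple, the `(θ, h)` the crux produces is admissible, carries `B16.EndStatementBPrinted (datum θ h).C`, AND — whenever `θ.τ9.M = F.L^a`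
and `1 ≤ θ.ν.r` (every witness of record: `M = L^j`, `r = 1`) — for all small windows `γ`, ALL lengths `K ≥ 1` and all `m`, a run of the record in `]0, γ]` whose LAST 𝐃-CUBE DOES NOT
FIT THE TORUS, along which the record's §2 form holds at every level.  [III] Thm 1's conclusion OUTSIDE print's p.257, at every length.  LOCATED, count-neutral.
[cite: Balaban1989LargeFieldII, Thm 1 p.355; Balaban1988Convergent, Thm 1 p.262, (2.1) p.254, (2.5) p.255, p.257; Balaban1987RG1, (0.20) p.256, (1.20)–(1.22) p.264] -/
theorem incompatibleRuns_of_stabilityBRunRowsAtRecordR13SepCoPH (hK1 : Summit.QuantumFields.YangMills.Theses.BalabanUVNodes.StabilityBRunRowsAtRecordR13SepCoPH)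
    (F : T4Family) (hinh : ∃ θ : Stage13HParams F 2, θ.Provisos₁₃SepCoPH F 2 ∧ (θ.ZhUnity F 2 ∧ θ.SlotsNondegenerate₁₃ F 2) ∧ θ.Admissible F 2) :
    ∃ (θ : Stage13HParams F 2) (h : θ.Provisos₁₃SepCoPH F 2), θ.Admissible F 2 ∧ B16.EndStatementBPrinted (datumOfRecord₁₃SepCoPH F 2 θ h).C ∧
      ∀ a : ℕ, θ.τ9.M = F.L ^ a → 1 ≤ θ.ν.r → ∃ γs : ℝ, 0 < γs ∧ ∀ γ : ℝ, 0 < γ → γ ≤ γs → ∀ K : ℕ, 1 ≤ K → ∀ m : ℕ, ∃ g0 : ℝ,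
        Step.InInterval γ K (gOfRecord₁₃ F 2 θ.toStage13Params ⟨K, m, g0⟩) ∧ ¬ PartCompat₁₃ F 2 θ.toStage13Params ⟨K, m, g0⟩ K ∧
          ∀ k, k ≤ K → ((datumOfRecord₁₃SepCoPH F 2 θ h).C ⟨K, m, g0⟩).Sect2Form k := by
  obtain ⟨θ, h, hbody⟩ := hK1 F hinh
  exact ⟨θ, h, hbody.2.1, hbody.2.2.1, fun a hM hr => incompatibleRuns_with_sect2Form_of_consequentBody₈ θ h hM hr hbody⟩

/-- **★★★ β-FREE TWIN FOR K1⁸** (θ produced with `θ.τ9.M = F.L^a`, `θ.ν.r = 1` — the witness shape): the crux's consequent ⇒ ONE run of positive length, NOT `PartCompat₁₃` at its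
last level, with the record's §2 form at every level — read off `EndStatementBPrinted`'s printed window `γ₂`, the window clause's `γ₁` and the threshold `e^{−L^{m−a}∕2}` of p615408
(`not_partCompat₁₃_top_of_window_lt_threshold`); no run row is read. [cite: Balaban1989LargeFieldII, Thm 1 p.355; Balaban1988Convergent, (2.5) p.255, p.257; Balaban1987RG1, Thm 1 p.259] -/
theorem incompatibleRun_of_stabilityBRunRowsAtRecordR13SepCoPH (hK1 : Summit.QuantumFields.YangMills.Theses.BalabanUVNodes.StabilityBRunRowsAtRecordR13SepCoPH)
    (F : T4Family) (hinh : ∃ θ : Stage13HParams F 2, θ.Provisos₁₃SepCoPH F 2 ∧ (θ.ZhUnity F 2 ∧ θ.SlotsNondegenerate₁₃ F 2) ∧ θ.Admissible F 2) :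
    ∃ (θ : Stage13HParams F 2) (h : θ.Provisos₁₃SepCoPH F 2), θ.Admissible F 2 ∧ B16.EndStatementBPrinted (datumOfRecord₁₃SepCoPH F 2 θ h).C ∧
      ∀ a : ℕ, θ.τ9.M = F.L ^ a → θ.ν.r = 1 → ∃ P : B12.RunParams, 1 ≤ P.K ∧ ¬ PartCompat₁₃ F 2 θ.toStage13Params P P.K ∧
        ∀ k, k ≤ P.K → ((datumOfRecord₁₃SepCoPH F 2 θ h).C P).Sect2Form k := by
  obtain ⟨θ, h, -, hθ, hB, ⟨γ₁, hγ₁, hwin⟩, -⟩ := hK1 F hinh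
  refine ⟨θ, h, hθ, hB, fun a hM hr => ?_⟩
  obtain ⟨⟨γ₂, hγ₂, hS⟩, -⟩ := hB
  set t : ℝ := Real.exp (-((F.L ^ (F.m - a) : ℕ) : ℝ) / 2) with ht
  have htpos : 0 < t := Real.exp_pos _
  set γ : ℝ := min (min γ₁ γ₂) (t / 2) with hγdef
  have hγpos : 0 < γ := lt_min (lt_min hγ₁ hγ₂) (by linarith)
  have hγ1 : γ ≤ γ₁ := (min_le_left _ _).trans (min_le_left _ _)
  have hγ2 : γ ≤ γ₂ := (min_le_left _ _).trans (min_le_right _ _)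
  have hγt : γ < t := by
    have := min_le_right (min γ₁ γ₂) (t / 2)
    linarith
  obtain ⟨P, hK, hW⟩ := hwin γ hγpos hγ1
  refine ⟨P, hK, ?_, fun k hk => hS P (fun j hj => ⟨(hW j hj).1, (hW j hj).2.trans hγ2⟩) k hk⟩
  exact not_partCompat₁₃_top_of_window_lt_threshold θ.toStage13Params hM hr P hK (fun j hj => hW j hj) hγt

end Crux

end Summit.QuantumFields.YangMills.Theorems.BalabanUVNodesN11K1RunRowsConsequentMeetsIncompatibleRuns

end
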